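import Literature.NumberTheory.LFunctions.KroneckerCharacter

/-!
# Zhang (2022) rescue bed (D-0124 (3)): the pre-registered MODULI of node group 1 — lists as defs, the all-inert
# ladder and small-`L(1,χ_D)` champion RULES as predicates, kernel checks of the spec's anchors

Topic `Literature/NumberTheory/LFunctions/Zhang2022` (Landau–Siegel audit tree; verdict-neutral), cell
landau-siegel, LS RESCUE PROTOCOL (human ruling D-0124) part (3) «GENUINE BED — explicit characters/moduli + the
actual mean values … the refuted premise asserts; pre-registered ranges», typer seat ls-rescue-typ-1 (REPOINT of
ls-rescue-lead 2026-08-27T06:59:49Z: typ-2 queue #4 «pre-registered moduli lists as defs» + #1 «explicit Kronecker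
`χ_Δ` terms», the latter in `Literature/NumberTheory/LFunctions/KroneckerCharacter.lean`). Y. Zhang, *Discrete mean
estimates and the Landau–Siegel zero*, arXiv:2211.02515v1 (2022) [Zhang2022LandauSiegel] — an unrefereed manuscript
under adjudication. **Nothing in this file asserts or denies any of its claims; nothing here is a claim about
Landau–Siegel zeros. The programme SEARCHES and TYPES; no claim about Landau–Siegel zeros, Theorems 1–2 of
arXiv:2211.02515 or a repaired Margin232 until a kernel theorem says so.**

Source of the objects: the bed-1 pre-registration `rescue/ls-rescue-bed-1/bed1-KG1-v0.1.json` (sha16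
`dea02fd073922aeb`, PREREG of record 06:57:27Z), block `moduli` — "`chi_D` := Kronecker symbol `(D/.)`, `D` a
FUNDAMENTAL discriminant (engine asserts isfundamental(D)); conductor `|D|`", lists `L1a_class_number_one`,
`L1b_coverage`, rules `L1y_all_inert_ladder_RULE` ("for each `y` … and each sign `s`: `D_y^s` := the fundamental
discriminant of sign `s` with the LEAST `|D|` such that `|D| > 4` and `chi_D(p) = -1` for EVERY prime `p <= y`",
with `known_anchors_for_selfcheck`) and `L2_champions_RULE` ("among fundamental discriminants `D` with
`200 < |D| <= B2`, separately for each sign: (a) the 15 `D` with the smallest `L(1,chi_D)`; (b) the 15 `D` with the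
smallest `L(1,chi_D) * log log |D|` … ties broken by smaller `|D|`", `B2_of_record = 3e5`).

## What is here

* LISTS as defs: `bed1ModuliL1a` (class number one), `bed1ModuliL1b` (coverage), `bed1LadderHeights` (the `y`-list),
  `bed1ChampionBound = 3·10⁵`, `bed1ChampionCount = 15`; `isFundamentalDiscriminant_of_mem_bed1Moduli` (PROVED by a
  finite square-freeness check): every listed modulus is a fundamental discriminant, so `χ_D = kroneckerChar D`
  (`KroneckerCharacter.lean`) has the Kronecker values at each (`isKroneckerChar_kroneckerChar`).
* RULES as predicates: `AllInertUpTo y D` («every prime `p ≤ y` inert», in Kronecker values: `D ≡ 5 (mod 8)` at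
  `p = 2`, `(D/p) = −1` at odd `p`), `IsLeastAllInert y s D` (rule L1y: `D_y^s`), `LOne D = Re L(1, χ_D)`,
  `lOneWeight`, `lOneLogLogWeight`, `IsChampionSet w s B k S` (rule L2). The engines' resolved tables must satisfy
  these row by row; minimality/extremality is their exhaustive search and is NOT certified here.
* KERNEL CHECKS of the spec's hand anchors (`known_anchors_for_selfcheck`): `allInertUpTo_three_neg19`,
  `not_allInertUpTo_three_neg7_neg11_neg15`, `allInertUpTo_seven_neg43` (∧ `11` splits),
  `allInertUpTo_thirteen_neg67` (∧ `17` splits), `allInertUpTo_thirtyseven_neg163` (∧ `41` splits) — consistent with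
  `D_3^- = −19`, `D_5^- = D_7^- = −43`, `D_11^- = D_13^- = −67`, `D_17^- = ⋯ = D_37^- = −163`
  ([LehmerLehmerShanks1970]: least discriminants with prescribed character at all small primes).

Honesty (rescue/BED.md §0.2): Assumption (A) is false at every modulus any engine reaches; these lists serve the
Tier-G1 «(A)-mimicry ladder» / «reality distance» rows, never a verdict on an (A)-guarded node. No `instance`, no
notation; decidable predicates where possible (`norm_num`'s `jacobiSym` extension evaluates `AllInertUpTo`).

## References

* D. H. Lehmer, E. Lehmer, D. Shanks, *Integer sequences having prescribed quadratic character*, Math. Comp. 24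
  (1970) 433–451. [cite: LehmerLehmerShanks1970, §1]
* D. Shanks, *Systematic examination of Littlewood's bounds on `L(1,χ)`*, Proc. Sympos. Pure Math. 24 (1973)
  267–283 (extreme values of `L(1,χ_d)`; the champion tables). [cite: Shanks1973LittlewoodBounds, §1]
* M. Watkins, *Class numbers of imaginary quadratic fields*, Math. Comp. 73 (2004) 907–938 (class number one:
  `−3, −4, −7, −8, −11, −19, −43, −67, −163`). [cite: Watkins2004ClassNumbers, §1]
* Y. Zhang, arXiv:2211.02515v1 (2022), §2 Assumption (A), (2.4)–(2.5). [cite: Zhang2022LandauSiegel, §2]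
-/

noncomputable section

open Complex

namespace Literature.NumberTheory.LFunctions.Zhang2022.Repair.Bed

open Literature.NumberTheory.LFunctions.KroneckerCharacter
open Literature.NumberTheory.LFunctions.ChamizoJimenezUrroz2021 (IsKroneckerChar)
open Literature.Barriers.RiemannHypothesis (IsFundamentalDiscriminant)

/-! ## The pre-registered MODULI LISTS of bed node group 1 (spec `bed1-KG1-v0.1`, sha16 `dea02fd073922aeb`)

The lists are FIXED by pre-registration (rescue/BED.md §0.4); the two RULE lists (all-inert ladder `L1y`,
small-`L(1,χ_D)` champions `L2`) are typed as PREDICATES that the engines' resolved tables must satisfy. -/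

/-- **List `L1a`** — the nine class-number-one fundamental discriminants (bed-1 spec `moduli.L1a_class_number_one`).
[cite: Watkins2004ClassNumbers, §1] -/
def bed1ModuliL1a : List ℤ := [-3, -4, -7, -8, -11, -19, -43, -67, -163]

/-- **List `L1b`** — the coverage list of bed-1 spec `moduli.L1b_coverage`: degenerate small conductors `5, 8, 12`;
primes `≡ 1 (mod 4)`; odd characters of prime conductor; composite fundamental discriminants with `≥ 3` prime
factors (`−1155 = −3·5·7·11`, `1365 = 3·5·7·13`, `∏_{q∣D} q/(q+1) < 0.75`); a generic `h = 3` field (`−23`);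
even composite conductors — the bed's coverage of the character-dependent displays (2.4)–(2.5) of the manuscript.
[cite: Zhang2022LandauSiegel, §2 (2.4)–(2.5)] -/
def bed1ModuliL1b : List ℤ := [5, 8, 12, 13, 17, 21, 24, 28, 29, -15, -20, -23, -24, -1155, 1365]

/-- A finite square-freeness check: if no `x` with `2 ≤ x ≤ B` has `x² ∣ |z|` and `|z| < (B+1)²`, then `z` is
square-free, provided `z ≠ 0` (any square factor has a prime square factor `p² ≤ |z|`). Decidable hypotheses, for the certificates
below. [folklore] -/
private theorem squarefree_int_of_check (z : ℤ) (B : ℕ) (h0 : z.natAbs ≠ 0) (hB : z.natAbs < (B + 1) * (B + 1))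
    (h : ∀ x ≤ B, 2 ≤ x → ¬ x * x ∣ z.natAbs) : Squarefree z := by
  rw [← Int.squarefree_natAbs, Nat.squarefree_iff_prime_squarefree]
  intro x hx hdvd
  have hle : x * x ≤ z.natAbs := Nat.le_of_dvd (Nat.pos_of_ne_zero h0) hdvd
  have hxB : x ≤ B := by
    by_contra hxB
    have hBx : B + 1 ≤ x := by omega
    have : (B + 1) * (B + 1) ≤ x * x := Nat.mul_self_le_mul_self hBx
    omega
  exact h x hxB hx.two_le hdvd

/-- **Every pre-registered modulus of `L1a` and `L1b` is a fundamental discriminant** (so `kroneckerChar D` has the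
Kronecker values there, `isKroneckerChar_kroneckerChar`). Kernel certificate by finite check.
[cite: MontgomeryVaughan2007, §9.3] -/
theorem isFundamentalDiscriminant_of_mem_bed1Moduli :
    ∀ D ∈ bed1ModuliL1a ++ bed1ModuliL1b, IsFundamentalDiscriminant D := by
  intro D hD
  simp only [bed1ModuliL1a, bed1ModuliL1b, List.cons_append, List.nil_append, List.mem_cons,
    List.not_mem_nil, or_false] at hD
  rcases hD with rfl | rfl | rfl | rfl | rfl | rfl | rfl | rfl | rfl | rfl | rfl | rfl | rfl | rfl | rfl |
    rfl | rfl | rfl | rfl | rfl | rfl | rfl | rfl | rfl <;>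
  first
    | exact Or.inl ⟨by decide, squarefree_int_of_check _ 40 (by decide) (by decide) (by decide), by decide⟩
    | exact Or.inr ⟨by decide, by decide, squarefree_int_of_check _ 40 (by decide) (by decide) (by decide)⟩

/-- **The ladder heights `y` of rule `L1y`** (bed-1 spec `moduli.L1y_all_inert_ladder_RULE.y_list`): the primes
`3 ≤ y ≤ 101`. [cite: LehmerLehmerShanks1970, §1] -/
def bed1LadderHeights : List ℕ :=
  [3, 5, 7, 11, 13, 17, 19, 23, 29, 31, 37, 41, 43, 47, 53, 59, 61, 67, 71, 73, 79, 83, 89, 97, 101]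

/-- **«All primes `p ≤ y` are inert for `χ_D`»** in Kronecker values: at `p = 2` the rule `χ_D(2) = −1 ⟺
D ≡ 5 (mod 8)`, at an odd prime `p` the Legendre symbol `(D/p) = −1`. This is the defining property of the
«(A)-mimicry ladder» (rescue/BED.md §0.2 (H3), §3 L1): the genuine real character closest to the (A)-world up to
height `y`. Decidable by `norm_num` for explicit `D, y`. [cite: LehmerLehmerShanks1970, §1] -/
def AllInertUpTo (y : ℕ) (D : ℤ) : Prop :=
  (2 ≤ y → D % 8 = 5) ∧ ∀ p : ℕ, p.Prime → p ≠ 2 → p ≤ y → jacobiSym D p = -1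

/-- **Rule `L1y`: `D_y^s`** — `D` is THE fundamental discriminant of sign `s` with `|D| > 4`, all primes `p ≤ y`
inert, and least `|D|` among such (bed-1 spec `moduli.L1y_all_inert_ladder_RULE.rule`; the engines resolve it by
exhaustive search and the resolved table must satisfy this predicate row by row). [cite: LehmerLehmerShanks1970, §1] -/
def IsLeastAllInert (y : ℕ) (s : ℤ) (D : ℤ) : Prop :=
  IsFundamentalDiscriminant D ∧ Int.sign D = s ∧ 4 < |D| ∧ AllInertUpTo y D ∧
    ∀ D' : ℤ, IsFundamentalDiscriminant D' → Int.sign D' = s → 4 < |D'| → AllInertUpTo y D' → |D| ≤ |D'|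

/-- `AllInertUpTo` is antitone in the height. [cite: LehmerLehmerShanks1970, §1] -/
theorem AllInertUpTo.mono {y y' : ℕ} (hy : y ≤ y') {D : ℤ} (h : AllInertUpTo y' D) : AllInertUpTo y D :=
  ⟨fun h2 => h.1 (le_trans h2 hy), fun p hp hp2 hpy => h.2 p hp hp2 (le_trans hpy hy)⟩

/-- **`L(1, χ_D)`** as a real number: the real part of `L(1, kroneckerChar D)` (the value is real for a real
character); junk `0` at `D = 0`. The quantity of bed-1 rows G02 and of rule `L2`. [cite: Shanks1973LittlewoodBounds, §1] -/
def LOne (D : ℤ) : ℝ :=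
  if h : D = 0 then 0 else
    haveI : NeZero D.natAbs := ⟨Int.natAbs_ne_zero.mpr h⟩
    ((kroneckerChar D).LFunction 1).re

/-- The plain weight of rule `L2 (a)`: `w(D) = L(1, χ_D)`. [cite: Shanks1973LittlewoodBounds, §1] -/
def lOneWeight (D : ℤ) : ℝ := LOne D

/-- The weight of rule `L2 (b)`: `w(D) = L(1, χ_D) · log log |D|`. [cite: Shanks1973LittlewoodBounds, §1] -/
def lOneLogLogWeight (D : ℤ) : ℝ := LOne D * Real.log (Real.log |(D : ℝ)|)

/-- **Rule `L2`: a champion set** — `S` is THE set of the `k` fundamental discriminants of sign `s` with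
`200 < |D| ≤ B` of least weight `w` (ties broken by smaller `|D|`): every member beats every non-member in range
(bed-1 spec `moduli.L2_champions_RULE`: `k = 15`, `B = 3·10⁵` of record, `w ∈ {lOneWeight, lOneLogLogWeight}`, each
sign; the engines' four top-15 tables must satisfy this predicate). [cite: Shanks1973LittlewoodBounds, §1] -/
def IsChampionSet (w : ℤ → ℝ) (s : ℤ) (B k : ℕ) (S : Finset ℤ) : Prop :=
  S.card = k ∧
    (∀ D ∈ S, IsFundamentalDiscriminant D ∧ Int.sign D = s ∧ 200 < |D| ∧ |D| ≤ (B : ℤ)) ∧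
    ∀ D ∈ S, ∀ D' : ℤ, D' ∉ S → IsFundamentalDiscriminant D' → Int.sign D' = s → 200 < |D'| →
      |D'| ≤ (B : ℤ) → w D < w D' ∨ (w D = w D' ∧ |D| < |D'|)

/-- The champion bound of record `B₂ = 3·10⁵` (bed-1 spec `L2_champions_RULE.B2_of_record`). [cite: Shanks1973LittlewoodBounds, §1] -/
def bed1ChampionBound : ℕ := 300000

/-- The champion table length `k = 15` (bed-1 spec `L2_champions_RULE`). [cite: Shanks1973LittlewoodBounds, §1] -/
def bed1ChampionCount : ℕ := 15

/-! ## Kernel checks of the spec's hand anchors for the all-inert ladder (`known_anchors_for_selfcheck`) -/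

/-- Anchor: all primes `≤ 3` are inert for `D = −19` (`−19 ≡ 5 (mod 8)`, `(−19/3) = −1`). [cite: LehmerLehmerShanks1970, §1] -/
theorem allInertUpTo_three_neg19 : AllInertUpTo 3 (-19) := by
  refine ⟨fun _ => by norm_num, fun p hp hp2 hp3 => ?_⟩
  interval_cases p
  · norm_num at hp
  · norm_num at hp
  · exact absurd rfl hp2
  · norm_num

/-- Anchor: `−7`, `−11`, `−15` are NOT all-inert up to `3` (`−7 ≡ 1`, `−15 ≡ 1 (mod 8)` split at `2`;
`(−11/3) = +1`). [cite: LehmerLehmerShanks1970, §1] -/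
theorem not_allInertUpTo_three_neg7_neg11_neg15 :
    ¬ AllInertUpTo 3 (-7) ∧ ¬ AllInertUpTo 3 (-11) ∧ ¬ AllInertUpTo 3 (-15) := by
  refine ⟨fun h => ?_, fun h => ?_, fun h => ?_⟩
  · have := h.1 (by norm_num); norm_num at this
  · have := h.2 3 Nat.prime_three (by norm_num) le_rfl; norm_num at this
  · have := h.1 (by norm_num); norm_num at this

/-- Anchor: all primes `≤ 7` are inert for `D = −43`, and `11` is not (`(−43/11) = +1`): consistent with
`D_5^- = D_7^- = −43`, `D_11^- ≠ −43`. [cite: LehmerLehmerShanks1970, §1] -/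
theorem allInertUpTo_seven_neg43 : AllInertUpTo 7 (-43) ∧ ¬ AllInertUpTo 11 (-43) := by
  refine ⟨⟨fun _ => by norm_num, fun p hp hp2 hp7 => ?_⟩, fun h => ?_⟩
  · interval_cases p <;> (try norm_num at hp) <;> (try exact absurd rfl hp2) <;> norm_num
  · have := h.2 11 (by norm_num) (by norm_num) le_rfl; norm_num at this

/-- Anchor: all primes `≤ 13` are inert for `D = −67`, and `17` is not (`(−67/17) = +1`): consistent with
`D_11^- = D_13^- = −67`. [cite: LehmerLehmerShanks1970, §1] -/
theorem allInertUpTo_thirteen_neg67 : AllInertUpTo 13 (-67) ∧ ¬ AllInertUpTo 17 (-67) := by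
  refine ⟨⟨fun _ => by norm_num, fun p hp hp2 hp13 => ?_⟩, fun h => ?_⟩
  · interval_cases p <;> (try norm_num at hp) <;> (try exact absurd rfl hp2) <;> norm_num
  · have := h.2 17 (by norm_num) (by norm_num) le_rfl; norm_num at this

/-- Anchor: all primes `≤ 37` are inert for `D = −163` (all `p ≤ 37` inert in `ℚ(√−163)`), and `41` is not
(`χ_{−163}(41) = +1`): consistent with `D_17^- = ⋯ = D_37^- = −163`, `D_41^- > 163` in absolute value.
[cite: LehmerLehmerShanks1970, §1] -/
theorem allInertUpTo_thirtyseven_neg163 : AllInertUpTo 37 (-163) ∧ ¬ AllInertUpTo 41 (-163) := by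
  refine ⟨⟨fun _ => by norm_num, fun p hp hp2 hp37 => ?_⟩, fun h => ?_⟩
  · interval_cases p <;> (try norm_num at hp) <;> (try exact absurd rfl hp2) <;> norm_num
  · have := h.2 41 (by norm_num) (by norm_num) le_rfl; norm_num at this

end Literature.NumberTheory.LFunctions.Zhang2022.Repair.Bed

end
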